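import Literature.MathematicalPhysics.QuantumFieldTheory.Balaban1983to89.B13OpsYPencilDeltaALetters
import Literature.MathematicalPhysics.QuantumFieldTheory.Balaban1983to89.B9Thm311PosOfPrincipalAtLettersY

/-!
# `Balaban1983to89.B13CurlIncidenceNumerals` — T. Bałaban, *Propagators for lattice gauge theories in a background field*, Commun. Math. Phys. **99**
# (1985) 389–434 [Balaban1985BackgroundPropagators], (3.2)–(3.4) pp. 390–391 (the contour `∂p` of a plaquette and the covariant curl `D_U`), (3.10) p. 392
# (`D*_U`), (3.69) p. 404 («plaquettes containing the bond b»), (3.26) p. 395 and Thm 3.10 (3.107)–(3.108) p. 416; *Renormalization group approach to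
# lattice gauge field theories. II*, Commun. Math. Phys. **116** (1988) 1–22 [Balaban1988RG2Cluster] (2.5)–(2.7) pp. 12–13, p. 15: THE CURL ∕ CO-CURL ROW SUMS
# AND THE CONTOUR-INCIDENCE COUNT OF NODE 00's KERNELS AS NUMBERS — `c₁ = 4|c_f|`, `N_b = 4(d+1)`, `c₂ = 4(d+1)|c_f|` — and the N10 pencil packagings of
# module 76 (`B13OpsYPencilDeltaALetters` §4 ∕ §5 ∕ §6) fed with them.

THE BINDERS.  The N10 letter data of the local part `Δ(U) + Q*(U)aQ(U)` of `Δ_a(U)` along pv27's group pencil (module 76 §4), of the `Δ_a` socket (§5) and of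
the G-junction (§6) display, among NODE 00's numerals, the three COMBINATORIAL numerals of def-Y's real kernels `curlK i : Matrix (PlaqY i) (FBondY i) ℝ`
(the curl `∂(p, b) = ±c_f` on the four contour bonds of `p`, [B9] (3.2)–(3.4)), `cocurlK i = (curlK i)ᵀ` ((3.10)) and `edgeY i p : Fin 4 → FBondY i` (the contour):
`hc₁ : ∀ p, Σ_b |∂(p,b)| ≤ c₁`, `hc₂ : ∀ b, Σ_p |∂*(b,p)| ≤ c₂`, `hNb : ∀ b, #{(p,m) : b_m(p) = b} ≤ N_b` (together with `0 ≤ c₁, c₂, N_b`).  No tree theorem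
gives them as numbers (the tree's one incidence fact is n06's AGGREGATE bound `B9Thm311PosOfPrincipalAtLettersY.sum_edgeY_le`, cited below by name).

WHAT THIS FILE PROVES (kernel-checked; theorems only, 0 `def`).
* §1 `abs_curlK_le_mul_sum_ite` (`|∂(p,b)| ≤ |c_f|·Σ_{m<4} [b_m(p) = b]`, from NODE 00's `rfl`-level formula `B6AgreeLapV1Chart.toMatrix'_dcE`), private
  `sum_ite_edgeY_eq` (`Σ_b [b_m(p) = b] = 1`), ★ `sum_abs_curlK_le` — 76's `hc₁` WITH THE NUMBER **`c₁ = 4|c_f|`**.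
* §2 `card_filter_edgeY_eq_sum` (the incidence count as a double indicator sum), `sum_sum_ite_edgeY_le` (`Σ_pΣ_m [b_m(p) = b] ≤ 4(d+1)` = n06's `sum_edgeY_le` at
  the indicator of `b`), ★ `card_filter_edgeY_le` — 76's `hNb` WITH **`N_b = 4(d+1)`**, `abs_cocurlK_eq` (`|∂*(b,p)| = |∂(p,b)|`), ★ `sum_abs_cocurlK_le` — 76's `hc₂`
  WITH **`c₂ = 4(d+1)|c_f|`**.
* §3 module 76's three packagings with `hc₀ hc₂0 hc₁ hc₂ hNb0 hNb` DISCHARGED by §1–§2 and EVERY OTHER BINDER VERBATIM (the constants substituted in the size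
  letters): ★★ `rawEntryLetters_toMatrix_localDeltaA_prodCfg_curlNumerals` (76 §4, the local part), ★★ `rawEntryLetters_toMatrix_deltaAY_prodCfg_of_projection_curlNumerals`
  (76 §5, the `Δ_a` socket), ★★★ `rawEntryLetters_toMatrix_GAY_prodCfg_of_projection_curlNumerals` (76 §6, the G-junction modulo the projection term's letters `B_P`
  and N06's `IsUnit (Δ_a(U₀))` + kernel bound of `G(U₀)`): after this file the NODE-00 side of the G-junction displays only the background size `K₀` (`= 1` at
  `G ≤ U(N)` by 79's `B13GreenPrimeSymLettersOfReg335.norm_unit_le_one_of_mem`), the basis numerals `cb, cl` (`= 1` at the matrix units by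
  `B13MatrixUnitBasisNumerals`), `Rc`, `η`, and the averaging ∕ reading rows `hD hD′ hcQ hcQs hca hℓp hℓq` (located numerals of the N10 w-seat files
  `B13SiteReadingNumerals` ∕ `B13BlockBondReadingNumerals` ∕ `B13BondAveragingReadingNumerals`, consumed there BY NAME — nothing of them is restated here).

HONEST FRAMING: [folklore] finite-lattice bookkeeping over def-Y's `rfl`-level kernels (`curlK = toMatrix' (onFun (dcE c_f))`, `cocurlK = curlKᵀ`,
`edgeY p = (⟨p₋+e_ν, μ⟩, ⟨p₋, ν⟩, ⟨p₋, μ⟩, ⟨p₋+e_μ, ν⟩)`) composed with n06's incidence lemma and module 76 BY NAME; the `2d`-SHARP counts (each bond lies on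
exactly `2d` plaquettes) are NOT claimed — `4(d+1)` is the tree's incidence constant (`sum_edgeY_le`) and enters only the size letters; nothing of NODE 00's,
N06's or the lane's files is modified; nothing of Bałaban's is asserted beyond the cited tree theorems; the projection term `B_P`, N06's `IsUnit` ∕ kernel
bound, the background size and the averaging ∕ reading rows REMAIN DISPLAYED; N06 ∕ N10 NOT discharged; K1⁷ NOT closed; counts unmoved (typed 28∕28 ·
discharged 5∕27); 0 `sorry`, standard axioms; no `instance`, no notation; one finite 𝕋⁴ programme at fixed ε — R4 closes the conditional finite-𝕋⁴ rung
`BalabanLadder.UV` only; the YM mass gap (Clay) is NOT proved by any of this; nothing continuum ∕ ℝ⁴ ∕ OS.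

WHY THIS FILE (cell `pub-ymgap`, HUMAN RULING D-0062 ∕ D-0149, Track A node N10 = [B13]; width seat `pub-ymgap-dag-n10-w6` g4, self-located R455 (A) claim from
the N10 w-seats' census remark «remaining displayed in 76 §4: `K₀ c₁ c₂ N_b` and the basis numerals» (HOME INBOX l.32102); key K1⁷ stmt-QuantumFields-20542,
count-neutral helper).

References: T. Bałaban, CMP 99 (1985) 389–434 [Balaban1985BackgroundPropagators] (3.2)–(3.4) pp.390–391, (3.10) p.392, (3.26) p.395, Thm 3.4 (3.50) p.400,
(3.69) p.404, Thm 3.10 (3.107)–(3.108) p.416; CMP 116 (1988) 1–22 [Balaban1988RG2Cluster] (2.5)–(2.7) pp.12–13, p.15; CMP 98 (1985) 17–51 [Balaban1985Averaging]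
(5) p.18 (bonds and plaquettes of `T^{(j)}`).
-/

noncomputable section

namespace Literature.MathematicalPhysics.QuantumFieldTheory.Balaban1983to89.B13CurlIncidenceNumerals

open Finset Module
open scoped Matrix
open Literature.MathematicalPhysics.QuantumFieldTheory.Balaban1983to89
open Literature.MathematicalPhysics.QuantumFieldTheory.Balaban1983to89.B9Thm37GlueTorus (tdist1)
open Literature.MathematicalPhysics.QuantumFieldTheory.Balaban1983to89.B5TorusCover (UT)
open Literature.MathematicalPhysics.QuantumFieldTheory.Balaban1983to89.B13EntrywiseWalks (RawEntryLetters)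
open Literature.MathematicalPhysics.QuantumFieldTheory.Balaban1983to89.B9Eq39Adjoint (prodCfg)
open Literature.MathematicalPhysics.QuantumFieldTheory.Balaban1983to89.B6GlobalChartV1 (PV)
open Literature.MathematicalPhysics.QuantumFieldTheory.Balaban1983to89.B6KLevelCensusIndexV1 (KIdx)
open Literature.MathematicalPhysics.QuantumFieldTheory.Balaban1983to89.B15DeterminingSets (embIter)
open Literature.MathematicalPhysics.QuantumFieldTheory.Balaban1983to89.Node00
  (SiteY FBondY IBondY PlaqY CfgY BondParY SiteParY SiteOpY curlK cocurlK qK qsK aK edgeY hessY QY QsY aY gradY divY RY deltaAY GAY parBY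
    cocurlK_eq_transpose)
open Literature.MathematicalPhysics.QuantumFieldTheory.Balaban1983to89.B9Thm311PosOfPrincipalAtLettersY (sum_edgeY_le)
open Literature.MathematicalPhysics.QuantumFieldTheory.Balaban1983to89.B13OpsYPencilDeltaALetters
  (rawEntryLetters_toMatrix_localDeltaA_prodCfg rawEntryLetters_toMatrix_deltaAY_prodCfg_of_projection rawEntryLetters_toMatrix_GAY_prodCfg_of_projection)

variable {d ℓ : ℕ} {hd : 1 ≤ d + 1} {hL : Odd (ℓ + 1) ∧ 1 < ℓ + 1} {b₀ b₁ : ℝ}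
variable (i : KIdx d ℓ hd hL b₀ b₁)

/-! ## §1. The curl row sum: `Σ_b |∂(p,b)| ≤ 4|c_f|` -/

section Curl

open Classical in
/-- the curl kernel's entries are dominated by the contour indicator: `|∂(p,b)| ≤ |c_f|·Σ_{m<4} [b_m(p) = b]` (NODE 00's `rfl`-level formula
`∂(p,b) = c_f·([⟨p₋,μ⟩ = b] + [⟨p₋+e_μ,ν⟩ = b] − [⟨p₋+e_ν,μ⟩ = b] − [⟨p₋,ν⟩ = b])`, triangle inequality; the four indicator terms are `edgeY i p 2, 3, 0, 1`).
[cite: Balaban1985BackgroundPropagators, (3.2)–(3.4) pp.390–391, bookkeeping] -/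
theorem abs_curlK_le_mul_sum_ite (p : PlaqY i) (b : FBondY i) :
    |curlK i p b| ≤ |i.cf| * ∑ m : Fin 4, (if edgeY i p m = b then (1 : ℝ) else 0) := by
  have h : curlK i p b = i.cf * ((if (⟨p.src, p.μ⟩ : FBondY i) = b then 1 else 0) + (if (⟨p.src.shift p.μ, p.ν⟩ : FBondY i) = b then 1 else 0)
      - (if (⟨p.src.shift p.ν, p.μ⟩ : FBondY i) = b then 1 else 0) - (if (⟨p.src, p.ν⟩ : FBondY i) = b then 1 else 0)) :=
    B6AgreeLapV1Chart.toMatrix'_dcE _ _ p b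
  rw [h, abs_mul, Fin.sum_univ_four]
  refine mul_le_mul_of_nonneg_left ?_ (abs_nonneg _)
  show |_| ≤ (if (⟨p.src.shift p.ν, p.μ⟩ : FBondY i) = b then (1 : ℝ) else 0) + (if (⟨p.src, p.ν⟩ : FBondY i) = b then (1 : ℝ) else 0)
      + (if (⟨p.src, p.μ⟩ : FBondY i) = b then (1 : ℝ) else 0) + (if (⟨p.src.shift p.μ, p.ν⟩ : FBondY i) = b then (1 : ℝ) else 0)
  split_ifs <;> norm_num

open Classical in
/-- exactly one bond equals a given contour bond: `Σ_b [b_m(p) = b] = 1`. [folklore] -/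
private theorem sum_ite_edgeY_eq (p : PlaqY i) (m : Fin 4) : ∑ b : FBondY i, (if edgeY i p m = b then (1 : ℝ) else 0) = 1 := by
  rw [Finset.sum_ite_eq]; simp

open Classical in
/-- ★ **THE CURL ROW SUM** — module 76's binder `hc₁` with the number `c₁ = 4|c_f|`: `Σ_b |∂(p,b)| ≤ 4|c_f|` for every plaquette `p`.
[cite: Balaban1985BackgroundPropagators, (3.4) p.391 (the curl picks the four contour bonds), bookkeeping] -/
theorem sum_abs_curlK_le (p : PlaqY i) : ∑ b, |curlK i p b| ≤ 4 * |i.cf| := by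
  calc ∑ b, |curlK i p b| ≤ ∑ b : FBondY i, |i.cf| * ∑ m : Fin 4, (if edgeY i p m = b then (1 : ℝ) else 0) :=
        Finset.sum_le_sum fun b _ => abs_curlK_le_mul_sum_ite i p b
    _ = |i.cf| * ∑ m : Fin 4, ∑ b : FBondY i, (if edgeY i p m = b then (1 : ℝ) else 0) := by rw [← Finset.mul_sum, Finset.sum_comm]
    _ = 4 * |i.cf| := by simp only [sum_ite_edgeY_eq, Finset.sum_const, Finset.card_univ, Fintype.card_fin, nsmul_eq_mul]; push_cast; ring

end Curl

/-! ## §2. The contour-incidence count `N_b = 4(d+1)` and the co-curl row sum `c₂ = 4(d+1)|c_f|` -/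

section Incidence

open Classical in
/-- the contour-incidence count of a bond as a double indicator sum: `#{(p,m) : b_m(p) = b} = Σ_pΣ_m [b_m(p) = b]` (the dictionary between module 76's
`card`-binder `hNb` and n06's summed incidence form). [cite: Balaban1985BackgroundPropagators, (3.69) p.404 («plaquettes containing the bond b»), bookkeeping] -/
theorem card_filter_edgeY_eq_sum (b : FBondY i) :
    ((((Finset.univ : Finset (PlaqY i)) ×ˢ (Finset.univ : Finset (Fin 4))).filter fun pm => edgeY i pm.1 pm.2 = b).card : ℝ) =
      ∑ p : PlaqY i, ∑ m : Fin 4, (if edgeY i p m = b then (1 : ℝ) else 0) := by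
  rw [Finset.card_filter, Nat.cast_sum, Finset.sum_product]
  refine Finset.sum_congr rfl fun p _ => Finset.sum_congr rfl fun m _ => ?_
  split_ifs <;> simp

open Classical in
/-- `Σ_pΣ_m [b_m(p) = b] ≤ 4(d+1)` — n06's aggregate incidence bound `sum_edgeY_le` at the indicator of `b`.
[cite: Balaban1985BackgroundPropagators, (3.69) p.404 («plaquettes containing the bond b»), bookkeeping] -/
theorem sum_sum_ite_edgeY_le (b : FBondY i) : ∑ p : PlaqY i, ∑ m : Fin 4, (if edgeY i p m = b then (1 : ℝ) else 0) ≤ 4 * ((d : ℝ) + 1) := by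
  have h := sum_edgeY_le i (g := fun b' : FBondY i => if b' = b then (1 : ℝ) else 0) (fun b' => by positivity)
  have h1 : ∑ b' : FBondY i, (if b' = b then (1 : ℝ) else 0) = 1 := by rw [Finset.sum_ite_eq']; simp
  simpa [h1] using h

open Classical in
/-- ★ **THE CONTOUR-INCIDENCE COUNT** — module 76's binder `hNb` with the number `N_b = 4(d+1)`: every bond is the `m`-th contour bond of at most `4(d+1)`
pairs `(p, m)`. [cite: Balaban1985BackgroundPropagators, (3.2) p.390, (3.69) p.404, bookkeeping] -/
theorem card_filter_edgeY_le (b : FBondY i) :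
    ((((Finset.univ : Finset (PlaqY i)) ×ˢ (Finset.univ : Finset (Fin 4))).filter fun pm => edgeY i pm.1 pm.2 = b).card : ℝ) ≤ 4 * ((d : ℝ) + 1) := by
  rw [card_filter_edgeY_eq_sum]; exact sum_sum_ite_edgeY_le i b

/-- the co-curl kernel is the transpose of the curl kernel entrywise: `|∂*(b,p)| = |∂(p,b)|`. [cite: Balaban1985BackgroundPropagators, (3.10) p.392, dictionary] -/
theorem abs_cocurlK_eq (b : FBondY i) (p : PlaqY i) : |cocurlK i b p| = |curlK i p b| := by
  rw [cocurlK_eq_transpose]; rfl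

open Classical in
/-- ★ **THE CO-CURL ROW SUM** — module 76's binder `hc₂` with the number `c₂ = 4(d+1)|c_f|`: `Σ_p |∂*(b,p)| ≤ 4(d+1)|c_f|` for every bond `b`.
[cite: Balaban1985BackgroundPropagators, (3.10) p.392, (3.69) p.404, bookkeeping] -/
theorem sum_abs_cocurlK_le (b : FBondY i) : ∑ p, |cocurlK i b p| ≤ 4 * ((d : ℝ) + 1) * |i.cf| := by
  calc ∑ p, |cocurlK i b p| = ∑ p, |curlK i p b| := Finset.sum_congr rfl fun p _ => abs_cocurlK_eq i b p
    _ ≤ ∑ p : PlaqY i, |i.cf| * ∑ m : Fin 4, (if edgeY i p m = b then (1 : ℝ) else 0) := Finset.sum_le_sum fun p _ => abs_curlK_le_mul_sum_ite i p b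
    _ = |i.cf| * ∑ p : PlaqY i, ∑ m : Fin 4, (if edgeY i p m = b then (1 : ℝ) else 0) := by rw [Finset.mul_sum]
    _ ≤ |i.cf| * (4 * ((d : ℝ) + 1)) := mul_le_mul_of_nonneg_left (sum_sum_ite_edgeY_le i b) (abs_nonneg _)
    _ = 4 * ((d : ℝ) + 1) * |i.cf| := by ring

end Incidence

/-! ## §3. ★★ Module 76's pencil packagings fed with the three numerals -/

section Packaging

variable {𝔸 : Type} [NormedRing 𝔸] [NormedAlgebra ℂ 𝔸] [CompleteSpace 𝔸] [NormOneClass 𝔸]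
variable {ν : ℕ} {Nf : Fin ν → ℕ} [∀ j, NeZero (Nf j)]
variable {κ : Type} [Fintype κ] [DecidableEq κ] (b : Basis κ ℂ 𝔸)
variable (parS : SiteParY 𝔸 i) (Gp : SiteOpY 𝔸 i) (U₀ : CfgY 𝔸 i) (η : ℝ) {Rc K₀ : ℝ} {D : ℕ}

open Classical in
/-- ★★ **THE LOCAL PART `Δ(U) + Q*(U)aQ(U)` ALONG THE PENCIL, CURL NUMERALS DISCHARGED** — module 76 §4 `rawEntryLetters_toMatrix_localDeltaA_prodCfg` with
`c₁ := 4|c_f|`, `c₂ := 4(d+1)|c_f|`, `N_b := 4(d+1)` (§1–§2) and every other binder verbatim: background size `K₀`, `0 ≤ Rc`, the averaging support ∕ row-sum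
numerals `D, c_Q, c_{Q*}, c_a`, the basis numerals `cb, cl`, the bond reading `ℓB` with its numeral `s`.
[cite: Balaban1985BackgroundPropagators, (3.26) p.395, (3.10) p.392, Thm 3.4 and (3.50) p.400, Thm 3.10 (3.107)–(3.108) p.416; Balaban1988RG2Cluster, (2.5) p.12, p.15] -/
theorem rawEntryLetters_toMatrix_localDeltaA_prodCfg_curlNumerals
    (hU : ∀ μ x, ‖(U₀ μ x : 𝔸)‖ ≤ K₀) (hUi : ∀ μ x, ‖(((U₀ μ x)⁻¹ : 𝔸ˣ) : 𝔸)‖ ≤ K₀) (hK1 : 1 ≤ K₀) (hRc : 0 ≤ Rc)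
    (hD : ∀ ι b, qK i ι b ≠ 0 → Site.tdist (embIter (ι.1.1 : ℕ) ι.1.2.src) b.src ≤ D)
    (hD' : ∀ b ι, qsK i b ι ≠ 0 → Site.tdist (embIter (ι.1.1 : ℕ) ι.1.2.src) b.src ≤ D)
    {cQ cQs ca : ℝ} (hcQ0 : 0 ≤ cQ) (hcQs0 : 0 ≤ cQs) (hca0 : 0 ≤ ca) (hcQ : ∀ ι, ∑ b, |qK i ι b| ≤ cQ) (hcQs : ∀ b, ∑ ι, |qsK i b ι| ≤ cQs)
    (hca : ∀ ι, ∑ ι', |aK i ι ι'| ≤ ca)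
    {cb cl : ℝ} (hcb : ∀ (a : 𝔸) (k : κ), ‖b.repr a k‖ ≤ cb * ‖a‖) (hcb0 : 0 ≤ cb) (hcl : ∀ l, ‖b l‖ ≤ cl) (hcl0 : 0 ≤ cl)
    (ℓB : FBondY i → UT Nf) {s : ℝ}
    (hℓp : ∀ p m l, tdist1 Nf (ℓB (edgeY i p m)) (ℓB (edgeY i p l)) ≤ s)
    (hℓq : ∀ b ι ι' b', qsK i b ι ≠ 0 → aK i ι ι' ≠ 0 → qK i ι' b' ≠ 0 → tdist1 Nf (ℓB b) (ℓB b') ≤ s)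
    {ρ : ℝ} (hρ : 0 ≤ ρ) :
    RawEntryLetters (fun a : Fin (d + 1) → Site (PV d ℓ i.m i.K hd hL) 0 → 𝔸 =>
        LinearMap.toMatrix ((Pi.basis fun _ : FBondY i => b).reindex (Equiv.sigmaEquivProd (FBondY i) κ))
          ((Pi.basis fun _ : FBondY i => b).reindex (Equiv.sigmaEquivProd (FBondY i) κ))
          (hessY i (prodCfg U₀ η a) + QsY i (parBY i) (prodCfg U₀ η a) ∘ₗ aY i ∘ₗ QY i (parBY i) (prodCfg U₀ η a)))
      (fun p : FBondY i × κ => ℓB p.1) Rc ρ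
      (cb * (((4 * ((d : ℝ) + 1) * |i.cf|) * (K₀ * Real.exp (|η| * Rc) *
          ((K₀ * Real.exp (|η| * Rc)) ^ 4 * ((4 * |i.cf|) * (K₀ * Real.exp (|η| * Rc) * cl * (K₀ * Real.exp (|η| * Rc))))) *
          (K₀ * Real.exp (|η| * Rc))) +
        1 / 2 * ((4 * ((d : ℝ) + 1)) * (K₀ * Real.exp (|η| * Rc) *
          (2 * (i.cf ^ 2 * (K₀ * Real.exp (|η| * Rc)) ^ 4) * (8 * (K₀ * Real.exp (|η| * Rc) * cl * (K₀ * Real.exp (|η| * Rc))))) *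
          (K₀ * Real.exp (|η| * Rc))))) +
      cQs * ((K₀ * Real.exp (|η| * Rc)) ^ D *
        (ca * (cQ * ((K₀ * Real.exp (|η| * Rc)) ^ D * cl * (K₀ * Real.exp (|η| * Rc)) ^ D))) * (K₀ * Real.exp (|η| * Rc)) ^ D)) * Real.exp (ρ * s)) :=
  rawEntryLetters_toMatrix_localDeltaA_prodCfg i b U₀ η hU hUi hK1 hRc (by positivity) (by positivity) (sum_abs_curlK_le i)
    (sum_abs_cocurlK_le i) (by positivity) (card_filter_edgeY_le i) hD hD' hcQ0 hcQs0 hca0 hcQ hcQs hca hcb hcb0 hcl hcl0 ℓB hℓp hℓq hρ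

open Classical in
/-- ★★ **THE `Δ_a` SOCKET, CURL NUMERALS DISCHARGED** — module 76 §5 `rawEntryLetters_toMatrix_deltaAY_prodCfg_of_projection` with `c₁ := 4|c_f|`,
`c₂ := 4(d+1)|c_f|`, `N_b := 4(d+1)`; the projection term's pencil letters `B_P` and all other binders displayed verbatim.
[cite: Balaban1985BackgroundPropagators, (3.25)–(3.26) pp.394–395, Thm 3.4 and (3.50) p.400, (3.108) p.416; Balaban1988RG2Cluster, (2.5) p.12, p.15] -/
theorem rawEntryLetters_toMatrix_deltaAY_prodCfg_of_projection_curlNumerals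
    (hU : ∀ μ x, ‖(U₀ μ x : 𝔸)‖ ≤ K₀) (hUi : ∀ μ x, ‖(((U₀ μ x)⁻¹ : 𝔸ˣ) : 𝔸)‖ ≤ K₀) (hK1 : 1 ≤ K₀) (hRc : 0 ≤ Rc)
    (hD : ∀ ι b, qK i ι b ≠ 0 → Site.tdist (embIter (ι.1.1 : ℕ) ι.1.2.src) b.src ≤ D)
    (hD' : ∀ b ι, qsK i b ι ≠ 0 → Site.tdist (embIter (ι.1.1 : ℕ) ι.1.2.src) b.src ≤ D)
    {cQ cQs ca : ℝ} (hcQ0 : 0 ≤ cQ) (hcQs0 : 0 ≤ cQs) (hca0 : 0 ≤ ca) (hcQ : ∀ ι, ∑ b, |qK i ι b| ≤ cQ) (hcQs : ∀ b, ∑ ι, |qsK i b ι| ≤ cQs)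
    (hca : ∀ ι, ∑ ι', |aK i ι ι'| ≤ ca)
    {cb cl : ℝ} (hcb : ∀ (a : 𝔸) (k : κ), ‖b.repr a k‖ ≤ cb * ‖a‖) (hcb0 : 0 ≤ cb) (hcl : ∀ l, ‖b l‖ ≤ cl) (hcl0 : 0 ≤ cl)
    (ℓB : FBondY i → UT Nf) {s : ℝ}
    (hℓp : ∀ p m l, tdist1 Nf (ℓB (edgeY i p m)) (ℓB (edgeY i p l)) ≤ s)
    (hℓq : ∀ b ι ι' b', qsK i b ι ≠ 0 → aK i ι ι' ≠ 0 → qK i ι' b' ≠ 0 → tdist1 Nf (ℓB b) (ℓB b') ≤ s)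
    {ρ : ℝ} (hρ : 0 ≤ ρ)
    {BP : ℝ}
    (hP : RawEntryLetters (fun a : Fin (d + 1) → Site (PV d ℓ i.m i.K hd hL) 0 → 𝔸 =>
        LinearMap.toMatrix ((Pi.basis fun _ : FBondY i => b).reindex (Equiv.sigmaEquivProd (FBondY i) κ))
          ((Pi.basis fun _ : FBondY i => b).reindex (Equiv.sigmaEquivProd (FBondY i) κ))
          (gradY i (prodCfg U₀ η a) ∘ₗ RY i parS Gp (prodCfg U₀ η a) ∘ₗ divY i (prodCfg U₀ η a)))
      (fun p : FBondY i × κ => ℓB p.1) Rc ρ BP) :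
    RawEntryLetters (fun a : Fin (d + 1) → Site (PV d ℓ i.m i.K hd hL) 0 → 𝔸 =>
        LinearMap.toMatrix ((Pi.basis fun _ : FBondY i => b).reindex (Equiv.sigmaEquivProd (FBondY i) κ))
          ((Pi.basis fun _ : FBondY i => b).reindex (Equiv.sigmaEquivProd (FBondY i) κ)) (deltaAY i parS (parBY i) Gp (prodCfg U₀ η a)))
      (fun p : FBondY i × κ => ℓB p.1) Rc ρ
      (cb * (((4 * ((d : ℝ) + 1) * |i.cf|) * (K₀ * Real.exp (|η| * Rc) *
          ((K₀ * Real.exp (|η| * Rc)) ^ 4 * ((4 * |i.cf|) * (K₀ * Real.exp (|η| * Rc) * cl * (K₀ * Real.exp (|η| * Rc))))) *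
          (K₀ * Real.exp (|η| * Rc))) +
        1 / 2 * ((4 * ((d : ℝ) + 1)) * (K₀ * Real.exp (|η| * Rc) *
          (2 * (i.cf ^ 2 * (K₀ * Real.exp (|η| * Rc)) ^ 4) * (8 * (K₀ * Real.exp (|η| * Rc) * cl * (K₀ * Real.exp (|η| * Rc))))) *
          (K₀ * Real.exp (|η| * Rc))))) +
      cQs * ((K₀ * Real.exp (|η| * Rc)) ^ D *
        (ca * (cQ * ((K₀ * Real.exp (|η| * Rc)) ^ D * cl * (K₀ * Real.exp (|η| * Rc)) ^ D))) * (K₀ * Real.exp (|η| * Rc)) ^ D)) * Real.exp (ρ * s) + BP) :=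
  rawEntryLetters_toMatrix_deltaAY_prodCfg_of_projection i b parS Gp U₀ η hU hUi hK1 hRc (by positivity) (by positivity) (sum_abs_curlK_le i)
    (sum_abs_cocurlK_le i) (by positivity) (card_filter_edgeY_le i) hD hD' hcQ0 hcQs0 hca0 hcQ hcQs hca hcb hcb0 hcl hcl0 ℓB hℓp hℓq hρ hP

open Classical in
/-- ★★★ **THE G-JUNCTION MODULO THE PROJECTION TERM, CURL NUMERALS DISCHARGED** — module 76 §6 `rawEntryLetters_toMatrix_GAY_prodCfg_of_projection` (Sect. B's
(3.84)–(3.86) for `G = Δ_a⁻¹` at NODE 00's objects along pv27's pencil) with `c₁ := 4|c_f|`, `c₂ := 4(d+1)|c_f|`, `N_b := 4(d+1)`.  STILL DISPLAYED: the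
projection term's pencil letters `B_P`; N06's `IsUnit (Δ_a(U₀))` and the pointwise kernel bound of `G(U₀)` (`B_G`, rate `ρ` through `ℓB`); NODE 00's background
size `K₀`, the averaging rows `hD hD′ hcQ hcQs hca`, the basis numerals `cb, cl`; the reading rows `hℓp hℓq`, a fibre bound `m`; `0 < Rc`; the target rate
`0 ≤ ρ′ < ρ`.  [cite: Balaban1985BackgroundPropagators, (3.26)–(3.27) p.395, Thm 3.4 and (3.50) p.400, (3.84)–(3.86) p.407, Thm 3.10 (3.107)–(3.108) p.416;
Balaban1988RG2Cluster, (2.5)–(2.7) pp.12–13, p.15; Balaban1984PropagatorsII, Lemma 2.1 (2.61) p.234] -/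
theorem rawEntryLetters_toMatrix_GAY_prodCfg_of_projection_curlNumerals
    (hU : ∀ μ x, ‖(U₀ μ x : 𝔸)‖ ≤ K₀) (hUi : ∀ μ x, ‖(((U₀ μ x)⁻¹ : 𝔸ˣ) : 𝔸)‖ ≤ K₀) (hK1 : 1 ≤ K₀) (hRc : 0 < Rc)
    (hD : ∀ ι b, qK i ι b ≠ 0 → Site.tdist (embIter (ι.1.1 : ℕ) ι.1.2.src) b.src ≤ D)
    (hD' : ∀ b ι, qsK i b ι ≠ 0 → Site.tdist (embIter (ι.1.1 : ℕ) ι.1.2.src) b.src ≤ D)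
    {cQ cQs ca : ℝ} (hcQ0 : 0 ≤ cQ) (hcQs0 : 0 ≤ cQs) (hca0 : 0 ≤ ca) (hcQ : ∀ ι, ∑ b, |qK i ι b| ≤ cQ) (hcQs : ∀ b, ∑ ι, |qsK i b ι| ≤ cQs)
    (hca : ∀ ι, ∑ ι', |aK i ι ι'| ≤ ca)
    {cb cl : ℝ} (hcb : ∀ (a : 𝔸) (k : κ), ‖b.repr a k‖ ≤ cb * ‖a‖) (hcb0 : 0 ≤ cb) (hcl : ∀ l, ‖b l‖ ≤ cl) (hcl0 : 0 ≤ cl)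
    (ℓB : FBondY i → UT Nf) {s : ℝ}
    (hℓp : ∀ p m l, tdist1 Nf (ℓB (edgeY i p m)) (ℓB (edgeY i p l)) ≤ s)
    (hℓq : ∀ b ι ι' b', qsK i b ι ≠ 0 → aK i ι ι' ≠ 0 → qK i ι' b' ≠ 0 → tdist1 Nf (ℓB b) (ℓB b') ≤ s)
    {m : ℕ} (hfib : ∀ y : UT Nf, (univ.filter fun p : FBondY i × κ => ℓB p.1 = y).card ≤ m)
    {ρ : ℝ} (hρ : 0 ≤ ρ)
    {BP : ℝ}
    (hP : RawEntryLetters (fun a : Fin (d + 1) → Site (PV d ℓ i.m i.K hd hL) 0 → 𝔸 =>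
        LinearMap.toMatrix ((Pi.basis fun _ : FBondY i => b).reindex (Equiv.sigmaEquivProd (FBondY i) κ))
          ((Pi.basis fun _ : FBondY i => b).reindex (Equiv.sigmaEquivProd (FBondY i) κ))
          (gradY i (prodCfg U₀ η a) ∘ₗ RY i parS Gp (prodCfg U₀ η a) ∘ₗ divY i (prodCfg U₀ η a)))
      (fun p : FBondY i × κ => ℓB p.1) Rc ρ BP)
    (hunit : IsUnit (deltaAY i parS (parBY i) Gp U₀)) {BG : ℝ} (hBG : 0 ≤ BG)
    (hO : ∀ b' c (E : 𝔸), ‖GAY i parS (parBY i) Gp U₀ (Pi.single b' E) c‖ ≤ BG * ‖E‖ * Real.exp (-(ρ * tdist1 Nf (ℓB c) (ℓB b'))))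
    {ρ' : ℝ} (hρ'0 : 0 ≤ ρ') (hρ' : ρ' < ρ) :
    RawEntryLetters (fun a : Fin (d + 1) → Site (PV d ℓ i.m i.K hd hL) 0 → 𝔸 =>
        LinearMap.toMatrix ((Pi.basis fun _ : FBondY i => b).reindex (Equiv.sigmaEquivProd (FBondY i) κ))
          ((Pi.basis fun _ : FBondY i => b).reindex (Equiv.sigmaEquivProd (FBondY i) κ)) (GAY i parS (parBY i) Gp (prodCfg U₀ η a)))
      (fun p : FBondY i × κ => ℓB p.1)
      (Rc / (4 * ((cb * (((4 * ((d : ℝ) + 1) * |i.cf|) * (K₀ * Real.exp (|η| * Rc) *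
          ((K₀ * Real.exp (|η| * Rc)) ^ 4 * ((4 * |i.cf|) * (K₀ * Real.exp (|η| * Rc) * cl * (K₀ * Real.exp (|η| * Rc))))) *
          (K₀ * Real.exp (|η| * Rc))) +
        1 / 2 * ((4 * ((d : ℝ) + 1)) * (K₀ * Real.exp (|η| * Rc) *
          (2 * (i.cf ^ 2 * (K₀ * Real.exp (|η| * Rc)) ^ 4) * (8 * (K₀ * Real.exp (|η| * Rc) * cl * (K₀ * Real.exp (|η| * Rc))))) *
          (K₀ * Real.exp (|η| * Rc))))) +
      cQs * ((K₀ * Real.exp (|η| * Rc)) ^ D *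
        (ca * (cQ * ((K₀ * Real.exp (|η| * Rc)) ^ D * cl * (K₀ * Real.exp (|η| * Rc)) ^ D))) * (K₀ * Real.exp (|η| * Rc)) ^ D)) * Real.exp (ρ * s) + BP) *
          (cb * cl * BG) * (m * B6.c0 1 ((ρ - ρ') / 3) ^ ν) * (m * B6.c0 1 ((ρ - ρ') / 3) ^ ν)) + 1))
      ρ' (2 * (cb * cl * BG)) :=
  rawEntryLetters_toMatrix_GAY_prodCfg_of_projection i b parS Gp U₀ η hU hUi hK1 hRc (by positivity) (by positivity) (sum_abs_curlK_le i)
    (sum_abs_cocurlK_le i) (by positivity) (card_filter_edgeY_le i) hD hD' hcQ0 hcQs0 hca0 hcQ hcQs hca hcb hcb0 hcl hcl0 ℓB hℓp hℓq hfib hρ hP hunit hBG hO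
    hρ'0 hρ'

end Packaging

end Literature.MathematicalPhysics.QuantumFieldTheory.Balaban1983to89.B13CurlIncidenceNumerals

end
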